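import Summits.Ventures.PercRepro.S2SharpPairs
import Summits.Ventures.PercRepro.S2SquareMultiplicity3

/-!
# PercRepro — S2: THE LEVEL COUNT INDEXED BY SPANNING `(q + 1)`-SETS, PART A (p7, gen 3; sub-claim S2)

p8's level count (RankLevelSetDepCountGiantA/A2/B/B2) indexes the fibres by PAIRS `(C, B′)`; the multiplicity
`S2.card_spanF_ge_three` is a statement about SETS — a rank-`q` set `B` of `m` elements has `≥ (m − q) + 3·C(m − q, 2)`
spanning `(q + 1)`-subsets `D` (`r(D) = q`, `B ⊆ cl D`). Indexing by the sets themselves (`spanAll M q` = the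
`(q + 1)`-subsets of `E` of rank `q`) gives the same double count and fibre bounds, and the GIANT class is then
bounded by the binomial `C(|F|, q + 1)` (all giant sets are subsets of the one giant flat `F`), instead of the pair
count `Σ_k s_k·C(|F| − k, q + 1 − k)`:

* `spanAll`, `fibreS` (the level-`m` fibre of a set `S`: the rank-`q` `m`-sets `B` with `S ⊆ B ⊆ cl S`);
* **`mul_card_levelF_le_sum_spanAll`** — `(m − q + 3·C(m − q, 2))·#levelF ≤ Σ_{S ∈ spanAll} #fibreS S m`;
* **`card_fibreS_le_choose`** — `#fibreS S m ≤ C(|cl S ∖ S|, m − q − 1)`;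
* **`exists_pair_of_mem_spanAll`** — every `S ∈ spanAll` is `C ∪ B′` for a pair `(C, B′) ∈ pairsF` (a circuit inside `S`);
* **`card_spanAll_le`** — `#spanAll ≤ #pairsF` (so `≤ Σ_k s_k·C(n − k, q + 1 − k)` by `card_pairsF_le'`).
Axioms: standard.
-/

open scoped Matroid

namespace PercRepro

namespace S2

open Set Finset

variable {α : Type} {M : Matroid α}

open scoped Classical in
/-- The spanning `(q + 1)`-sets: `(q + 1)`-subsets of `E` of rank `q`, as a finset of sets. -/
noncomputable def spanAll (M : Matroid α) [M.Finite] (q : ℕ) : Finset (Set α) :=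
  (((Matroid.groundF M).powersetCard (q + 1)).filter
    (fun D : Finset α => M.eRk (D : Set α) = (q : ℕ∞))).image (fun D : Finset α => (D : Set α))

open scoped Classical in
/-- The level-`m` fibre of a set `S`: the rank-`q` `m`-element sets `B` with `S ⊆ B ⊆ cl S`. -/
noncomputable def fibreS (M : Matroid α) [M.Finite] (q : ℕ) (S : Set α) (m : ℕ) : Finset (Finset α) :=
  (Matroid.levelF M q m).filter (fun B => S ⊆ (B : Set α) ∧ (B : Set α) ⊆ M.closure S)

/-- Membership in `spanAll`. -/
theorem mem_spanAll [M.Finite] {q : ℕ} {S : Set α} :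
    S ∈ spanAll M q ↔ S ⊆ M.E ∧ S.ncard = q + 1 ∧ M.eRk S = (q : ℕ∞) := by
  classical
  unfold spanAll
  rw [Finset.mem_image]
  constructor
  · rintro ⟨D, hD, rfl⟩
    rw [Finset.mem_filter, Finset.mem_powersetCard] at hD
    refine ⟨?_, by rw [Set.ncard_coe_finset]; exact hD.1.2, hD.2⟩
    rw [← Matroid.coe_groundF]
    exact_mod_cast hD.1.1
  · rintro ⟨hSE, hSc, hSr⟩
    have hfin : S.Finite := M.ground_finite.subset hSE
    refine ⟨hfin.toFinset, ?_, by simp⟩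
    rw [Finset.mem_filter, Finset.mem_powersetCard]
    refine ⟨⟨?_, by rw [← Set.ncard_eq_toFinset_card S hfin]; exact hSc⟩, by simpa using hSr⟩
    intro x hx
    rw [Set.Finite.mem_toFinset] at hx
    rw [Matroid.groundF, Set.Finite.mem_toFinset]
    exact hSE hx

open scoped Classical in
/-- A spanning `(q + 1)`-subset of `B` (in `spanF M q B`) lies in `spanAll` and has `B` in its fibre. -/
theorem mem_spanAll_of_mem_spanF [M.Finite] {q : ℕ} {B : Finset α} (hBE : (B : Set α) ⊆ M.E) {D : Set α}
    (hD : D ∈ spanF M q B) : D ∈ spanAll M q ∧ D ⊆ (B : Set α) ∧ (B : Set α) ⊆ M.closure D := by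
  obtain ⟨D', hD'B, hD'c, hD'r, hBcl, rfl⟩ := (mem_spanF (M := M)).1 hD
  refine ⟨?_, by exact_mod_cast hD'B, hBcl⟩
  rw [mem_spanAll]
  refine ⟨(Finset.coe_subset.2 hD'B).trans hBE, by rw [Set.ncard_coe_finset]; exact hD'c, hD'r⟩

open scoped Classical in
/-- **The level-`m` double count over spanning sets**:
`((m − q) + 3·C(m − q, 2))·#levelF M q m ≤ Σ_{S ∈ spanAll M q} #fibreS M q S m`. -/
theorem mul_card_levelF_le_sum_spanAll [M.Finite] (q : ℕ) (hq : 1 ≤ q)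
    (hcirc : ∀ C, M.IsCircuit C → 3 ≤ C.encard) (hC1 : ∀ L ⊆ M.E, M.eRk L = 2 → L.ncard ≤ 3) (m : ℕ) :
    ((m - q) + 3 * (m - q).choose 2) * (Matroid.levelF M q m).card ≤
      ∑ S ∈ spanAll M q, (fibreS M q S m).card := by
  have hcomm : ∑ S ∈ spanAll M q, (fibreS M q S m).card =
      ∑ B ∈ Matroid.levelF M q m, ((spanAll M q).filter (fun S => S ⊆ (B : Set α) ∧
        (B : Set α) ⊆ M.closure S)).card := by
    unfold fibreS
    simp only [Finset.card_filter]
    exact Finset.sum_comm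
  rw [hcomm]
  calc ((m - q) + 3 * (m - q).choose 2) * (Matroid.levelF M q m).card
      = ∑ _B ∈ Matroid.levelF M q m, ((m - q) + 3 * (m - q).choose 2) := by simp [mul_comm]
    _ ≤ _ := by
      apply Finset.sum_le_sum
      intro B hB
      obtain ⟨hBg, hBm, hBq⟩ := Matroid.mem_levelF.1 hB
      have hBE : (B : Set α) ⊆ M.E := by rw [← Matroid.coe_groundF]; exact_mod_cast hBg
      have h := card_spanF_ge_three q hq hcirc hC1 hBE hBq
      rw [hBm] at h
      refine h.trans (Finset.card_le_card ?_)
      intro D hD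
      rw [Finset.mem_filter]
      obtain ⟨h1, h2, h3⟩ := mem_spanAll_of_mem_spanF hBE hD
      exact ⟨h1, h2, h3⟩

open scoped Classical in
/-- **The fibre at one level**: `#fibreS M q S m ≤ C(|cl S ∖ S|, m − (q + 1))` — `B ↦ B ∖ S` is injective into the
`(m − q − 1)`-subsets of the free points of the closure. -/
theorem card_fibreS_le_choose [M.Finite] (q : ℕ) {S : Set α} (hS : S ∈ spanAll M q) (m : ℕ) :
    (fibreS M q S m).card ≤ (M.closure S \ S).ncard.choose (m - (q + 1)) := by
  obtain ⟨hSE, hSc, -⟩ := mem_spanAll.1 hS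
  have hSfin : S.Finite := M.ground_finite.subset hSE
  have hFfin : (M.closure S).Finite := M.ground_finite.subset (M.closure_subset_ground _)
  have hDfin : (M.closure S \ S).Finite := hFfin.subset Set.sdiff_subset
  have hSF : S ⊆ M.closure S := M.subset_closure S hSE
  rw [Set.ncard_eq_toFinset_card _ hDfin, ← Finset.card_powersetCard (m - (q + 1)) hDfin.toFinset]
  apply Finset.card_le_card_of_injOn (fun B => B \ hSfin.toFinset)
  · intro B hB
    rw [Finset.mem_coe] at hB
    unfold fibreS at hB
    rw [Finset.mem_filter] at hB
    obtain ⟨hBl, hSB, hBcl⟩ := hB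
    obtain ⟨-, hBm, -⟩ := Matroid.mem_levelF.1 hBl
    rw [Finset.mem_coe, Finset.mem_powersetCard]
    constructor
    · intro x hx
      rw [Finset.mem_sdiff, Set.Finite.mem_toFinset] at hx
      rw [Set.Finite.mem_toFinset]
      exact ⟨hBcl (by exact_mod_cast hx.1), hx.2⟩
    · have hSB' : hSfin.toFinset ⊆ B := by
        intro x hx
        rw [Set.Finite.mem_toFinset] at hx
        exact_mod_cast hSB hx
      rw [Finset.card_sdiff, Finset.inter_eq_left.2 hSB', hBm, ← Set.ncard_eq_toFinset_card _ hSfin, hSc]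
  · intro B hB B' hB' hBB'
    rw [Finset.mem_coe] at hB hB'
    unfold fibreS at hB hB'
    rw [Finset.mem_filter] at hB hB'
    have hSB : hSfin.toFinset ⊆ B := by
      intro x hx
      rw [Set.Finite.mem_toFinset] at hx
      exact_mod_cast hB.2.1 hx
    have hSB' : hSfin.toFinset ⊆ B' := by
      intro x hx
      rw [Set.Finite.mem_toFinset] at hx
      exact_mod_cast hB'.2.1 hx
    have h1 : B = (B \ hSfin.toFinset) ∪ hSfin.toFinset := (Finset.sdiff_union_of_subset hSB).symm
    have h2 : B' = (B' \ hSfin.toFinset) ∪ hSfin.toFinset := (Finset.sdiff_union_of_subset hSB').symm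
    rw [h1, h2]
    have hBB'' : B \ hSfin.toFinset = B' \ hSfin.toFinset := hBB'
    rw [hBB'']

open scoped Classical in
/-- **Every spanning set is the union of a pair**: `S ∈ spanAll M q` contains a circuit `C` (it is dependent), and
`(C, S ∖ C) ∈ pairsF M q` with `C ∪ (S ∖ C) = S`. -/
theorem exists_pair_of_mem_spanAll [M.Finite] (q : ℕ) (hcirc : ∀ C, M.IsCircuit C → 3 ≤ C.encard)
    {S : Set α} (hS : S ∈ spanAll M q) :
    ∃ p ∈ Matroid.pairsF M q, p.1 ∪ p.2 = S := by
  obtain ⟨hSE, hSc, hSr⟩ := mem_spanAll.1 hS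
  have hSfin : S.Finite := M.ground_finite.subset hSE
  have hdep : M.Dep S := by
    rw [_root_.Matroid.dep_iff]
    refine ⟨fun hind => ?_, hSE⟩
    have := hind.eRk_eq_encard
    rw [hSr, ← hSfin.cast_ncard_eq, hSc] at this
    have h' : q = q + 1 := by exact_mod_cast this
    omega
  obtain ⟨C, hCS, hC⟩ := hdep.exists_isCircuit_subset
  have hCfin : C.Finite := hSfin.subset hCS
  have hC3 : 3 ≤ C.ncard := by
    have := hcirc C hC
    rw [← hCfin.cast_ncard_eq] at this
    exact_mod_cast this
  have hCle : C.ncard ≤ q + 1 := by rw [← hSc]; exact Set.ncard_le_ncard hCS hSfin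
  refine ⟨(C, S \ C), ?_, by simp [Set.union_sdiff_cancel hCS]⟩
  unfold Matroid.pairsF
  rw [Finset.mem_filter, Finset.mem_biUnion]
  refine ⟨⟨C.ncard, Finset.mem_Icc.2 ⟨hC3, hCle⟩, ?_⟩, Set.disjoint_sdiff_left, ?_⟩
  · rw [Finset.mem_product]
    refine ⟨Matroid.mem_circF.2 ⟨hC, rfl⟩, Matroid.mem_subsF_of ?_ ?_⟩
    · rw [Matroid.coe_groundF]; exact Set.sdiff_subset.trans hSE
    · rw [Set.ncard_sdiff hCS hCfin, hSc]
  · simp only [Set.union_sdiff_cancel hCS]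
    rw [hSr]

open scoped Classical in
/-- **`#spanAll ≤ #pairsF`**: `S ↦ (C_S, S ∖ C_S)` is injective (the pair's union is `S`). -/
theorem card_spanAll_le [M.Finite] (q : ℕ) (hcirc : ∀ C, M.IsCircuit C → 3 ≤ C.encard) :
    (spanAll M q).card ≤ (Matroid.pairsF M q).card := by
  apply Finset.card_le_card_of_surjOn (fun p : Set α × Set α => p.1 ∪ p.2)
  intro S hS
  rw [Finset.mem_coe] at hS
  obtain ⟨p, hp, hpS⟩ := exists_pair_of_mem_spanAll q hcirc hS
  exact ⟨p, Finset.mem_coe.2 hp, hpS⟩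

end S2

end PercRepro
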